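import Mathlib
import Literature.Topology.FourManifolds.BranchedDoubleQuotient
import Literature.Geometry.Kaehler.RealStructure
import HarnessLib

/-!
# The Arnold–Rokhlin quotient `X/conj` of a real surface is a smooth `4`-manifold (named fact)

Topic `Literature/Topology/FourManifolds`; namespace `Literature.Topology.FourManifolds`.
A FACT file (D-0014) recording the EXISTENCE half of the classical statement that the orbit space
of the complex conjugation of a nonsingular compact complex surface carries a smooth structure for
which the projection is a double covering branched along the real part — the construction that
the definition file `BranchedDoubleQuotient.lean` deliberately left out ("Deliberately not here …
EXISTENCE of `(Y, q)` … (`RqQuotientExists`)"). It grounds the support item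
`Summit.SmoothPoincare4.SmoothPoincare4.Theses.RealQuotientSpheres.RqQuotientExists`
(stmt-SmoothPoincare4-7155), which is this fact with the predicate `IsBranchedDoubleQuotient`
unfolded coordinatewise (`rqQuotientExists_shape_of_fact` below performs the unfolding).

Sources, read at page level:
* Finashin, J. reine angew. Math. 481 (1996) = arXiv:dg-ga/9506007, §1 ¶2 (p. 1), verbatim:
  "This paper is devoted to studying the topology of quotients `Y = X/conj` for nonsingular Real
  surfaces `(X, conj)`. The quotient `Y` inherits from `X` an orientation and a smooth structure,
  which makes the projection `q : X → Y` an orientation preserving and smooth `2`-fold covering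
  branched along the real part `X_ℝ` of `X`, the fixed point set of conj".
* Degtyarev–Kharlamov, Russian Math. Surveys 55 (2000) = arXiv:math/0004134, §3.2 (p. 14),
  verbatim: "the fixed point set of the complex conjugation has codimension `2`. Hence, the
  quotient `X/conj` is a manifold; moreover, one can easily see that, up to isotopy, there is a
  unique smooth structure on `X/conj` such that the projection `X → X/conj` is a double covering
  branched over `ℝX`."
* Kuiper, Math. Ann. 208 (1974); Massey, Geom. Dedicata 2 (1973): the case `ℂℙ²/conj ≅ S⁴`.

Dictionary. "Real surface" = compact complex-analytic surface `X` (charts in `ℂ²`,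
`IsManifold 𝓘(ℂ, ℂ²) ω`) with an anti-holomorphic involution `σ`
(`Literature.Geometry.Kaehler.IsAntiholomorphic`, Silhol's sheaf formulation, + `σ ∘ σ = id`);
"double covering branched along `X_ℝ`" = `IsBranchedDoubleQuotient σ q`
(`BranchedDoubleQuotient.lean`: quotient map with `σ`-orbit fibres, `C^∞`, a local diffeomorphism
off `Fix σ`, and the standard model `(z, w) ↦ (Re z, Re w, (Im z)² − (Im w)², 2 Im z Im w)` in
`σ`-adapted charts at the real points — the squaring map on the normal `O(2)`-bundle of the
totally real surface `X_ℝ`, obtained from `σ`-invariant exponential tubular coordinates with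
orthonormal normal frames; the route's refuter reviews checked that this clause is satisfiable and
is the standard meaning of "branched along `X_ℝ`"). A real point is assumed (`∃ x, σ x = x`), as
in the item; for `X_ℝ = ∅` the projection is an honest double covering (DK2000 p. 14) and the
statement is easier but not needed. Only EXISTENCE is vendored; uniqueness up to
isotopy/diffeomorphism (DK2000 §3.2; Bredon 1972 VI.2) is a separate statement.

## Mathlib / tree search

No quotient-manifold or branched-covering constructions in Mathlib (`lean search 'branched|
Branched|orbitSpace.*Manifold'`: prose only); tree: `IsBranchedDoubleQuotient`,
`branchedDoubleModel(_apply/_star/_eq_iff)`, `contDiff_branchedDoubleModel`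
(`BranchedDoubleQuotient.lean`), `IsAntiholomorphic`, `RealStructure` (`RealStructure.lean`).

## References

* [Finashin1996] S. Finashin, *Rokhlin conjecture and quotients of complex surfaces by complex
  conjugation*, J. reine angew. Math. 481 (1996) 55–71 (arXiv:dg-ga/9506007), §1 ¶2.
* [DegtyarevKharlamov2000] A. Degtyarev, V. Kharlamov, *Topological properties of real algebraic
  varieties: du côté de chez Rokhlin*, Russian Math. Surveys 55 (2000) (arXiv:math/0004134), §3.2.
* [Kuiper1974] N. H. Kuiper, Math. Ann. 208 (1974) 175–177. [Massey1973] W. S. Massey, Geom.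
  Dedicata 2 (1973) 371–374.
-/

noncomputable section

open scoped Manifold ContDiff ComplexConjugate
open Set Function

namespace Literature.Topology.FourManifolds

/-- **Finashin 1996, §1 ¶2 / Degtyarev–Kharlamov 2000, §3.2 (existence of the smooth quotient
`X/conj`)**: for a compact complex surface `X` (Hausdorff, second countable, charts in `ℂ²`,
analytic) and an anti-holomorphic involution `σ` of `X` with a real point, there are a smooth
`4`-manifold `Y` (Hausdorff, second countable, `C^∞` structure modelled on `ℝ⁴`) and a map
`q : X → Y` which is the branched double quotient of `X` by `σ` with the standard local model
along `Fix σ` (`IsBranchedDoubleQuotient σ q`). Verbatim (Finashin): "The quotient `Y` inherits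
from `X` an orientation and a smooth structure, which makes the projection `q : X → Y` an
orientation preserving and smooth `2`-fold covering branched along the real part `X_ℝ` of `X`";
(Degtyarev–Kharlamov): "up to isotopy, there is a unique smooth structure on `X/conj` such that
the projection `X → X/conj` is a double covering branched over `ℝX`". Orientations and uniqueness
are not recorded. Grounds `Summit.SmoothPoincare4.SmoothPoincare4.Theses.RealQuotientSpheres.RqQuotientExists`.
[cite: Finashin1996, §1 Introduction ¶2 (arXiv:dg-ga/9506007 p. 1); DegtyarevKharlamov2000 §3.2] -/
def Finashin1996_conjQuotient_exists : Prop :=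
  ∀ (X : Type) [TopologicalSpace X] [T2Space X] [SecondCountableTopology X] [CompactSpace X]
    [ChartedSpace (Fin 2 → ℂ) X] [IsManifold 𝓘(ℂ, Fin 2 → ℂ) ω X] (σ : X → X),
    Literature.Geometry.Kaehler.IsAntiholomorphic 𝓘(ℂ, Fin 2 → ℂ) 𝓘(ℂ, Fin 2 → ℂ) σ →
    (∀ x, σ (σ x) = x) → (∃ x, σ x = x) →
    ∃ (Y : Type) (_ : TopologicalSpace Y) (_ : T2Space Y) (_ : SecondCountableTopology Y)
      (_ : ChartedSpace (EuclideanSpace ℝ (Fin 4)) Y) (_ : IsManifold (𝓡 4) ∞ Y) (q : X → Y),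
      IsBranchedDoubleQuotient σ q

/-- **The fact in the coordinatewise shape of the route item** `RqQuotientExists`
(stmt-SmoothPoincare4-7155): hypotheses `Continuous σ`, `σ ∘ σ = id`, a fixed point, and Silhol's
anti-holomorphy clause written with `starRingEnd ℂ`; conclusion the five clauses of
`IsBranchedDoubleQuotient` with the adapted-chart clause spelled out in the four real coordinates
of `branchedDoubleModel`. Pure unfolding (`branchedDoubleModel_apply`, `Pi.star_apply`).
[cite: Finashin1996, §1 Introduction ¶2 (arXiv:dg-ga/9506007 p. 1)] -/
theorem rqQuotientExists_shape_of_fact (h : Finashin1996_conjQuotient_exists) :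
    ∀ (X : Type) [TopologicalSpace X] [T2Space X] [SecondCountableTopology X] [CompactSpace X]
      [ChartedSpace (Fin 2 → ℂ) X] [IsManifold 𝓘(ℂ, Fin 2 → ℂ) ω X] (σ : X → X)
      (hσ : Continuous σ), (∀ x, σ (σ x) = x) → (∃ x, σ x = x) →
      (∀ (U : Set X) (f : X → ℂ), IsOpen U → MDifferentiableOn 𝓘(ℂ, Fin 2 → ℂ) 𝓘(ℂ, ℂ) f U →
        MDifferentiableOn 𝓘(ℂ, Fin 2 → ℂ) 𝓘(ℂ, ℂ) (fun x => starRingEnd ℂ (f (σ x))) (σ ⁻¹' U)) →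
      ∃ (Y : Type) (_ : TopologicalSpace Y) (_ : T2Space Y) (_ : SecondCountableTopology Y)
        (_ : ChartedSpace (EuclideanSpace ℝ (Fin 4)) Y) (_ : IsManifold (𝓡 4) ∞ Y) (q : X → Y),
        Topology.IsQuotientMap q ∧ (∀ x y, q x = q y ↔ (y = x ∨ y = σ x)) ∧
        ContMDiff 𝓘(ℝ, Fin 2 → ℂ) (𝓡 4) ∞ q ∧
        (∀ x, σ x ≠ x → IsLocalDiffeomorphAt 𝓘(ℝ, Fin 2 → ℂ) (𝓡 4) ∞ q x) ∧
        (∀ x, σ x = x → ∃ φ ∈ IsManifold.maximalAtlas 𝓘(ℝ, Fin 2 → ℂ) ∞ X,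
          ∃ ψ ∈ IsManifold.maximalAtlas (𝓡 4) ∞ Y, x ∈ φ.source ∧ ∀ y ∈ φ.source,
            σ y ∈ φ.source ∧ q y ∈ ψ.source ∧ φ (σ y) 0 = starRingEnd ℂ (φ y 0) ∧
            φ (σ y) 1 = starRingEnd ℂ (φ y 1) ∧ ψ (q y) 0 = (φ y 0).re ∧
            ψ (q y) 1 = (φ y 1).re ∧ ψ (q y) 2 = (φ y 0).im ^ 2 - (φ y 1).im ^ 2 ∧
            ψ (q y) 3 = 2 * (φ y 0).im * (φ y 1).im) := by
  intro X _ _ _ _ _ _ σ hσ hinv hfix hanti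
  have hA : Literature.Geometry.Kaehler.IsAntiholomorphic 𝓘(ℂ, Fin 2 → ℂ) 𝓘(ℂ, Fin 2 → ℂ) σ :=
    ⟨hσ, fun U hU f hf => hanti U f hU hf⟩
  obtain ⟨Y, i1, i2, i3, i4, i5, q, hq⟩ := h X σ hA hinv hfix
  refine ⟨Y, i1, i2, i3, i4, i5, q, hq.isQuotientMap, hq.apply_eq_iff, hq.contMDiff,
    hq.isLocalDiffeomorphAt, fun x hx => ?_⟩
  obtain ⟨φ, hφ, ψ, hψ, hxφ, hall⟩ := hq.exists_adapted_charts x hx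
  refine ⟨φ, hφ, ψ, hψ, hxφ, fun y hy => ?_⟩
  obtain ⟨h1, h2, h3, h4⟩ := hall y hy
  have e0 : φ (σ y) 0 = starRingEnd ℂ (φ y 0) := by
    rw [h2]; simp [Pi.star_apply]
  have e1 : φ (σ y) 1 = starRingEnd ℂ (φ y 1) := by
    rw [h2]; simp [Pi.star_apply]
  have c : ∀ j : Fin 4, ψ (q y) j = branchedDoubleModel (φ y) j := fun j => by rw [h4]
  refine ⟨h1, h3, e0, e1, ?_, ?_, ?_, ?_⟩
  · simpa [branchedDoubleModel_apply] using c 0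
  · simpa [branchedDoubleModel_apply] using c 1
  · simpa [branchedDoubleModel_apply] using c 2
  · simpa [branchedDoubleModel_apply] using c 3

end Literature.Topology.FourManifolds

end
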